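import Mathlib
import HarnessLib
import Summits.NavierStokesRegularity.NavierStokesRegularity.Theorems.SymmetryModuliCountFarPastLedger

/-!
# `SymmetryModuliCount.ForcedSymmetry` (crux stmt-NavierStokesRegularity-4052), line
# `recurrent-closing`, stub `stub_pressureStructure`: a global classical pressure, and the KNSS
# near/far structure of every classical pressure, for the Type-I ancient mild class

Support file (everything proved, kind = proof) for the lead's skeleton of the line
`recurrent-closing` (`Cruxes/ForcedSymmetry/Lines/recurrent_closing.lean`), sub-stub 1a
`stub_pressureStructure`. For every `u ∈ A_C` (`IsTypeIAncientMild C u`):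

* (i) `exists_isClassicalNSSolutionOn_Iio` — there is ONE pressure `p` with `(u, p)` a classical
  Navier–Stokes solution (unit viscosity, zero force) on the whole time set `(−∞, 0)`. Proof:
  glue the window pressures `Pₙ` on `(−(n+1), 0)` of the tree's
  `IsTypeIAncientMild.exists_isClassicalNSSolutionOn_Ioo` (KNSS-mild + smooth + bounded ⇒
  classical, Fabes–Jones–Rivière), each normalised by its value at the spatial origin
  (`isClassicalNSSolutionOn_Iio_glue`). Two classical pressures of the same velocity differ by a
  function of time only (`IsClassicalNSSolutionOn.pressure_sub_apply_zero_eq_of_eventuallyEq`),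
  so the normalised window pressures are compatible; joint smoothness is local (Mathlib
  `contDiffOn_of_locally_contDiffOn`), and at every `t < 0` the one-sided time derivative within
  `(−∞, 0)` is the two-sided one, as within any window.
* (ii) EVERY classical pressure `p` of `u` on `(−∞, 0)` has, at every `τ < 0` and centre `x₀`,
  the unit-scale near/far structure `p(τ) = c + p₁ + p₂` on `B(x₀, 2)` of
  `Theorems.nearFar_window` (fed with the landed slice harmonic analysis
  `Theorems.stub_fplSlicePressure`, whose constant `c₀` is the constant here): the structure of
  the window pressure on `(2τ, 0)` is transferred to `p` by the same rigidity, the difference (a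
  function of time alone) being absorbed in the constant `c`.

## References

* G. Koch, N. Nadirashvili, G. Seregin, V. Šverák, *Liouville theorems for the Navier–Stokes
  equations and applications*, Acta Math. 203 (2009), §3–4. [KochNadirashviliSereginSverak2009]
* E. B. Fabes, B. F. Jones, N. M. Rivière, *The initial value problem for the Navier–Stokes
  equations with data in `Lᵖ`*, Arch. Rational Mech. Anal. 45 (1972), Thm. 2.1.
  [FabesJonesRiviere1972]
-/

noncomputable section

-- the summit and its single problem share the name (D-0017 nested layout)
set_option linter.dupNamespace false

open MeasureTheory Set Metric Filter Function Topology
open scoped ContDiff Laplacian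

namespace Summit.NavierStokesRegularity.NavierStokesRegularity.Theorems.SymmetryModuliCountForcedSymmetry

open Literature.Analysis.FluidPDE

section Glue

variable {E : Type*} [NormedAddCommGroup E] [InnerProductSpace ℝ E] [FiniteDimensional ℝ E]

/-- Every negative time lies in the window `(−(⌊−t⌋₊ + 1), 0)` indexed by `⌊−t⌋₊ : ℕ`. -/
theorem mem_Ioo_neg_floor_of_neg {t : ℝ} (ht : t < 0) : t ∈ Ioo (-((⌊-t⌋₊ : ℝ) + 1)) 0 := by
  refine ⟨?_, ht⟩
  have h := Nat.lt_floor_add_one (-t)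
  linarith

/-- **Gluing countably many window solutions along `(−∞, 0)`.** If `(u, Pₙ)` is a classical
Navier–Stokes solution on the window `(−(n+1), 0)` for every `n : ℕ` (same velocity, viscosity
and force), then `u` with the pressure `p(t, x) = P_{⌊−t⌋₊}(t, x) − P_{⌊−t⌋₊}(t, 0)` is a
classical solution on `(−∞, 0)`. On each window `p` coincides with the normalised pressure
`Pₙ − Pₙ(·, 0)` (two pressures of one velocity differ by a function of time,
`pressure_sub_apply_zero_eq_of_eventuallyEq`), whence local — hence global — joint smoothness
(`contDiffOn_of_locally_contDiffOn`); the momentum equation at `t < 0` is that of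
`(u, P_{⌊−t⌋₊})` (two-sided time derivatives on open time sets, `∇(g − c) = ∇g`). -/
theorem isClassicalNSSolutionOn_Iio_glue {ν : ℝ} {f u : ℝ → E → E} {P : ℕ → ℝ → E → ℝ}
    (hP : ∀ n : ℕ, IsClassicalNSSolutionOn (Ioo (-((n : ℝ) + 1)) 0) ν f u (P n)) :
    IsClassicalNSSolutionOn (Iio 0) ν f u (fun t x => P ⌊-t⌋₊ t x - P ⌊-t⌋₊ t 0) := by
  -- the windows are relatively open pieces of `(−∞, 0) × E`
  have hpiece : ∀ n : ℕ, (Iio (0 : ℝ) ×ˢ (univ : Set E)) ∩ Ioo (-((n : ℝ) + 1)) 0 ×ˢ univ =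
      Ioo (-((n : ℝ) + 1)) 0 ×ˢ univ := fun n => by
    rw [prod_inter_prod, inter_self, inter_eq_right.2 Ioo_subset_Iio_self]
  -- compatibility of the normalised window pressures
  have hcompat : ∀ (n m : ℕ) (t : ℝ), t ∈ Ioo (-((n : ℝ) + 1)) 0 → t ∈ Ioo (-((m : ℝ) + 1)) 0 →
      ∀ x, P n t x - P n t 0 = P m t x - P m t 0 := fun n m t hn hm x =>
    (hP n).pressure_sub_apply_zero_eq_of_eventuallyEq (hP m) (Ioo_mem_nhds hn.1 hn.2)
      (Ioo_mem_nhds hm.1 hm.2) (Eventually.of_forall fun _ => rfl) x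
  refine ⟨?_, ?_, ?_, ?_⟩
  · -- joint smoothness of the velocity is local
    refine contDiffOn_of_locally_contDiffOn fun z hz => ?_
    obtain ⟨t, x⟩ := z
    have ht : t < 0 := hz.1
    have htI := mem_Ioo_neg_floor_of_neg ht
    refine ⟨Ioo (-((⌊-t⌋₊ : ℝ) + 1)) 0 ×ˢ univ, isOpen_Ioo.prod isOpen_univ, ⟨htI, mem_univ _⟩, ?_⟩
    rw [hpiece]
    exact (hP _).smooth_velocity
  · -- joint smoothness of the glued pressure is local
    refine contDiffOn_of_locally_contDiffOn fun z hz => ?_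
    obtain ⟨t, x⟩ := z
    have ht : t < 0 := hz.1
    have htI := mem_Ioo_neg_floor_of_neg ht
    refine ⟨Ioo (-((⌊-t⌋₊ : ℝ) + 1)) 0 ×ˢ univ, isOpen_Ioo.prod isOpen_univ, ⟨htI, mem_univ _⟩, ?_⟩
    rw [hpiece]
    refine (hP ⌊-t⌋₊).smooth_pressure.sub_apply_zero.congr fun z hz => ?_
    obtain ⟨τ, y⟩ := z
    have hτ : τ ∈ Ioo (-((⌊-t⌋₊ : ℝ) + 1)) 0 := hz.1
    simp only [uncurry_apply_pair]
    exact hcompat _ _ τ (mem_Ioo_neg_floor_of_neg hτ.2) hτ y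
  · -- the momentum equation at `t < 0` is that of `(u, P ⌊-t⌋₊)`
    intro t ht x
    have ht0 : t < 0 := ht
    have htI := mem_Ioo_neg_floor_of_neg ht0
    have hD : timeDerivWithin (Iio 0) u t x =
        timeDerivWithin (Ioo (-((⌊-t⌋₊ : ℝ) + 1)) 0) u t x := by
      simp only [timeDerivWithin_apply]
      rw [derivWithin_of_mem_nhds (Iio_mem_nhds ht0),
        derivWithin_of_mem_nhds (Ioo_mem_nhds htI.1 htI.2)]
    rw [hD]
    simp only [gradient_sub_const]
    exact (hP _).momentum t htI x
  · -- incompressibility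
    intro t ht
    exact (hP _).divFree t (mem_Ioo_neg_floor_of_neg ht)

variable [MeasurableSpace E] [BorelSpace E]

/-- **A Type I ancient mild field is a classical Navier–Stokes solution on the whole time set
`(−∞, 0)`** (unit viscosity, zero force), for some jointly smooth pressure: glue the window
pressures of `IsTypeIAncientMild.exists_isClassicalNSSolutionOn_Ioo` on `(−(n+1), 0)`, `n : ℕ`,
by `isClassicalNSSolutionOn_Iio_glue`. -/
theorem exists_isClassicalNSSolutionOn_Iio {C : ℝ} {u : ℝ → E → E} (hu : IsTypeIAncientMild C u) :
    ∃ p : ℝ → E → ℝ, IsClassicalNSSolutionOn (Iio 0) 1 0 u p := by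
  have hwin : ∀ n : ℕ, ∃ p : ℝ → E → ℝ,
      IsClassicalNSSolutionOn (Ioo (-((n : ℝ) + 1)) 0) 1 0 u p := fun n =>
    hu.exists_isClassicalNSSolutionOn_Ioo (by
      have h0 : (0 : ℝ) ≤ n := n.cast_nonneg
      linarith)
  choose P hP using hwin
  exact ⟨_, isClassicalNSSolutionOn_Iio_glue hP⟩

end Glue

/-- **Sub-stub 1a of the line `recurrent-closing` — global classical pressure with the KNSS
near/far structure.** There is `c₀ ≥ 0` (the constant of the slice harmonic analysis
`Theorems.stub_fplSlicePressure`) such that every `u ∈ A_C` (`IsTypeIAncientMild C u`)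
(i) admits a pressure `p` with `(u, p)` a classical Navier–Stokes solution on the whole time set
`(−∞, 0)` (`exists_isClassicalNSSolutionOn_Iio`), and (ii) EVERY classical pressure `p` of `u`
on `(−∞, 0)` has, at every time `τ < 0` and centre `x₀`, the unit-scale near/far structure
`p(τ) = c + p₁ + p₂` on `B(x₀, 2)` with `‖p₁‖₂² ≤ c₀ (C²/(−τ)) ∫_{B(x₀,4)} |u(τ)|²` and
`‖∇p₂‖ ≤ c₀ ∫_{B(x₀,3)ᶜ} |u(τ)|²/|y − x₀|⁴` on `B(x₀, 2)`: the structure of the window pressure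
of `Theorems.nearFar_window` on `(2τ, 0)`, transferred to `p` (two classical pressures of the
same velocity differ by a function of time only,
`IsClassicalNSSolutionOn.pressure_sub_apply_zero_eq_of_eventuallyEq`). -/
theorem stub_pressureStructure :
    ∃ c₀ : ℝ, 0 ≤ c₀ ∧ ∀ (C : ℝ) (u : ℝ → EuclideanSpace ℝ (Fin 3) → EuclideanSpace ℝ (Fin 3)),
      IsTypeIAncientMild C u →
      (∃ p : ℝ → EuclideanSpace ℝ (Fin 3) → ℝ, IsClassicalNSSolutionOn (Set.Iio 0) 1 0 u p) ∧
      ∀ p : ℝ → EuclideanSpace ℝ (Fin 3) → ℝ, IsClassicalNSSolutionOn (Set.Iio 0) 1 0 u p →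
        ∀ τ < (0 : ℝ), ∀ x₀ : EuclideanSpace ℝ (Fin 3),
          ∃ (c : ℝ) (p₁ p₂ : EuclideanSpace ℝ (Fin 3) → ℝ),
            (∀ x ∈ ball x₀ 2, p τ x = c + p₁ x + p₂ x) ∧ MemLp p₁ 2 volume ∧
            ∫ x, p₁ x ^ 2 ≤ c₀ * (C ^ 2 / (-τ)) * ∫ x in ball x₀ 4, ‖u τ x‖ ^ 2 ∧
            ∀ x ∈ ball x₀ 2, DifferentiableAt ℝ p₂ x ∧
              ‖fderiv ℝ p₂ x‖ ≤ c₀ * ∫ y in (ball x₀ 3)ᶜ, ‖u τ y‖ ^ 2 / ‖y - x₀‖ ^ 4 := by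
  obtain ⟨c₀, hc₀, hHA⟩ :=
    Summit.NavierStokesRegularity.NavierStokesRegularity.Theorems.stub_fplSlicePressure
  refine ⟨c₀, hc₀, fun C u hu =>
    ⟨exists_isClassicalNSSolutionOn_Iio hu, fun p hp τ hτ x₀ => ?_⟩⟩
  -- the window `(2τ, 0)` around `τ` and its structured pressure `p'`
  have h2τ : 2 * τ < 0 := by linarith
  have hτI : τ ∈ Ioo (2 * τ) 0 := ⟨by linarith, hτ⟩
  obtain ⟨p', hp', hstr⟩ :=
    Summit.NavierStokesRegularity.NavierStokesRegularity.Theorems.nearFar_window hHA hc₀ hu h2τ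
  obtain ⟨c, p₁, p₂, hdec, hmem, hnear, hfar⟩ := hstr τ hτI x₀
  -- `p(τ, ·)` and `p'(τ, ·)` differ by a constant
  have htr : ∀ x, p τ x - p τ 0 = p' τ x - p' τ 0 := fun x =>
    hp.pressure_sub_apply_zero_eq_of_eventuallyEq hp' (Iio_mem_nhds hτ) (Ioo_mem_nhds hτI.1 hτI.2)
      (Eventually.of_forall fun _ => rfl) x
  refine ⟨c + (p τ 0 - p' τ 0), p₁, p₂, fun x hx => ?_, hmem, hnear, hfar⟩
  have h1 := htr x
  have h2 := hdec x hx
  linarith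

end Summit.NavierStokesRegularity.NavierStokesRegularity.Theorems.SymmetryModuliCountForcedSymmetry

end
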